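import Summits.AtomisticToContinuum.Crystallization.Theorems.FrustratedLawDichotomyStrainedPatchHomEntrySignKit

/-!
# SYMMETRY REDUCTION of the fcc half of `(H)`, part 2b: the FUNDAMENTAL DOMAIN `u₁₁ ≤ u₀₀`, `u₂₂ ≤ u₁₁`, `0 ≤ u₀₁`, `0 ≤ u₀₂` (×24) and the
# certificate theorems over it

decomp-a2c hand-1 g21 (crux `AperiodicFrustratedLawGap`, stmt-AtomisticToContinuum-27623; CERT-DESIGN-g44 §0; sequel of `…HomEntrySym` (sorted diagonal,
×6) and `…HomEntrySignKit` (sign flips)).  `F₂` makes `u₀₂ ≥ 0`, then `F₁` makes `u₀₁ ≥ 0` (it leaves `u₀₂` alone), neither moves the diagonal; so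
the fcc dichotomy on the fundamental domain gives it everywhere.

* §4 ★★ `fccHalf_of_sortedSigned`: the fcc dichotomy (prune ∨ `m`-floor) for ALL self-adjoint positive `U` with `‖U − 1‖ ≤ 1/4` (= `hfcc` of
  `…HomPrunedPolar.homFloor_of_prunedBoxSums_selfAdjoint`, verbatim) from the dichotomy on the fundamental domain;
* §5 the vacuous-leaf verdict `signOut` (box has `u₀₁ < 0` or `u₀₂ < 0` throughout), `entryLeafOKD μ := signOut ∨ entryLeafOKS μ` (sign ∨ sort ∨ fit ∨
  symmetry ∨ column ∨ TABLE), ★★ `fccHalf_of_entryTreeDom` (generic verdict, hver relativised to the domain), `fccHalf_of_entrySearchDom`, and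
  ★★★ `homFloor_of_entrySearchesDom : 2(m + e_W)SC ≤ μ → searchOK (entryLeafOKD μ) … rootC rootW = true → searchOK (entryLeafOKH2 μ) … rootCH rootWH = true
  → HomFloor m` — the fcc search now visits ≈ 1/24 of the entry cube (plus boundary boxes).

0 sorry; standard axioms; no instances / notation / `#eval`.  `--supports stmt-AtomisticToContinuum-27623`.
-/

namespace Summit.AtomisticToContinuum.Crystallization.Theorems.FrustratedLawDichotomyStrainedPatchHomEntrySign

open scoped BigOperators RealInnerProductSpace
open Literature.Analysis.ValidatedNumerics.Numerics
open Summit.AtomisticToContinuum.Crystallization.Theorems.ChargedEnergyGapNegative (E3)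
open Summit.AtomisticToContinuum.Crystallization.Theorems.FrustratedLawDichotomySchurCut (effPot w₄₅ ω₄)
open Summit.AtomisticToContinuum.Crystallization.Theorems.FrustratedLawDichotomyAveragingRuleTightFree (TightNearCap BadNearCap)
open Summit.AtomisticToContinuum.Crystallization.Theorems.FrustratedLawDichotomyExemptAbsorption (ExemptNear)
open Summit.AtomisticToContinuum.Crystallization.Theorems.FrustratedLawDichotomyStrainedPatchHomSplit
open Summit.AtomisticToContinuum.Crystallization.Theorems.FrustratedLawDichotomyStrainedPatchHomPolar (latPt_comp)
open Summit.AtomisticToContinuum.Crystallization.Theorems.FrustratedLawDichotomyStrainedPatchHomIsometry (pruneFcc_comp)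
open Summit.AtomisticToContinuum.Crystallization.Theorems.FrustratedLawDichotomyStrainedPatchHomTermCalculus (effPot45_eq_far)
open Summit.AtomisticToContinuum.Crystallization.Theorems.FrustratedLawDichotomyStrainedPatchHomLeafTableCheck (nbZ norm_sq_fccComb far_of_nb)
open Summit.AtomisticToContinuum.Crystallization.Theorems.FrustratedLawDichotomyStrainedPatchHomPrunedPolar (homFloor_of_prunedBoxSums_selfAdjoint)
open Summit.AtomisticToContinuum.Crystallization.Theorems.FrustratedLawDichotomyStrainedPatchHomCertTree (CertTree treeOK treeOK_sound)
open Summit.AtomisticToContinuum.Crystallization.Theorems.FrustratedLawDichotomyStrainedPatchHomEntryGram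
open Summit.AtomisticToContinuum.Crystallization.Theorems.FrustratedLawDichotomyStrainedPatchHomEntryGramHcp (rootCH rootWH)
open Summit.AtomisticToContinuum.Crystallization.Theorems.FrustratedLawDichotomyStrainedPatchHomEntryFitHcp (entryLeafOKH2 entryLeafOKH2_sound)
open Summit.AtomisticToContinuum.Crystallization.Theorems.FrustratedLawDichotomyStrainedPatchHomEntryTable (muRec)
open Summit.AtomisticToContinuum.Crystallization.Theorems.FrustratedLawDichotomyStrainedPatchHomEntrySearch
open Summit.AtomisticToContinuum.Crystallization.Theorems.FrustratedLawDichotomyStrainedPatchHomEntrySym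
open Literature.Barriers.AtomisticToContinuum.FlatleyTheil2015 (fccVec)

open Summit.AtomisticToContinuum.Crystallization.Theorems.FrustratedLawDichotomyStrainedPatchHomEntrySignKit

/-! ## §4. The reduction to the fundamental domain `u₁₁ ≤ u₀₀`, `u₂₂ ≤ u₁₁`, `0 ≤ u₀₁`, `0 ≤ u₀₂` -/

/-- ★★ **REDUCTION TO THE FUNDAMENTAL DOMAIN (×24).**  If the fcc dichotomy (prune ∨ `m`-floor) holds for every self-adjoint positive `U` with
`‖U − 1‖ ≤ 1/4`, sorted diagonal and `0 ≤ u₀₁`, `0 ≤ u₀₂`, it holds for every self-adjoint positive `U` with `‖U − 1‖ ≤ 1/4` (= `hfcc`). [folklore] -/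
theorem fccHalf_of_sortedSigned {m : ℝ}
    (h : ∀ U : E3 →L[ℝ] E3, (∀ v w : E3, inner ℝ (U v) w = inner ℝ v (U w)) → (∀ w : E3, 0 ≤ inner ℝ w (U w)) → ‖U - 1‖ ≤ 1 / 4 →
      (U (EuclideanSpace.single 1 (1 : ℝ))) 1 ≤ (U (EuclideanSpace.single 0 (1 : ℝ))) 0 →
      (U (EuclideanSpace.single 2 (1 : ℝ))) 2 ≤ (U (EuclideanSpace.single 1 (1 : ℝ))) 1 →
      0 ≤ (U (EuclideanSpace.single 1 (1 : ℝ))) 0 → 0 ≤ (U (EuclideanSpace.single 2 (1 : ℝ))) 0 →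
      (∀ (M : ℕ) (z : Fin M → E3) (c : Fin M), Function.Injective z →
          Set.range z = {x : E3 | dist x (z c) ≤ 133 / 10 ∧ ∃ a : Fin 3 → ℤ, x = z c + latPt U fccVec a} →
          TightNearCap (9 / 5) (3 / 2) z c ∨ ExemptNear (9 / 5) ExRec z c ∨ BadNearCap (9 / 5) (3 / 2) z c) ∨
      m ≤ (∑ b ∈ (Fintype.piFinset fun _ : Fin 3 => Finset.Icc (-7 : ℤ) 7).filter (fun b => b ≠ 0),
        effPot w₄₅ ω₄ (3 / 400) ‖latPt U fccVec b‖) / 2 - (-(7175 / 10000) + 3 / 400)) :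
    ∀ U : E3 →L[ℝ] E3, (∀ v w : E3, inner ℝ (U v) w = inner ℝ v (U w)) → (∀ w : E3, 0 ≤ inner ℝ w (U w)) → ‖U - 1‖ ≤ 1 / 4 →
      (∀ (M : ℕ) (z : Fin M → E3) (c : Fin M), Function.Injective z →
          Set.range z = {x : E3 | dist x (z c) ≤ 133 / 10 ∧ ∃ a : Fin 3 → ℤ, x = z c + latPt U fccVec a} →
          TightNearCap (9 / 5) (3 / 2) z c ∨ ExemptNear (9 / 5) ExRec z c ∨ BadNearCap (9 / 5) (3 / 2) z c) ∨
      m ≤ (∑ b ∈ (Fintype.piFinset fun _ : Fin 3 => Finset.Icc (-7 : ℤ) 7).filter (fun b => b ≠ 0),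
        effPot w₄₅ ω₄ (3 / 400) ‖latPt U fccVec b‖) / 2 - (-(7175 / 10000) + 3 / 400) := by
  -- entries of the two conjugates used below (`F₂`: `u₀₂ ↦ −u₀₂`; `F₁`: `u₀₁ ↦ −u₀₁`; diagonal and the other sign fixed as needed)
  have E : ∀ (i : Fin 3) (U : E3 →L[ℝ] E3) (a b : Fin 3), a ≠ i → b ≠ i →
      (((flipIso i : E3 →L[ℝ] E3).comp (U.comp ((flipIso i).symm : E3 →L[ℝ] E3))) (EuclideanSpace.single b (1 : ℝ))) a =
        (U (EuclideanSpace.single b (1 : ℝ))) a := fun i U a b ha hb => by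
    rw [flip_entry, if_neg ha, if_neg hb]; ring
  have Ed : ∀ (i : Fin 3) (U : E3 →L[ℝ] E3),
      (((flipIso i : E3 →L[ℝ] E3).comp (U.comp ((flipIso i).symm : E3 →L[ℝ] E3))) (EuclideanSpace.single i (1 : ℝ))) i =
        (U (EuclideanSpace.single i (1 : ℝ))) i := fun i U => by
    rw [flip_entry, if_pos rfl]; ring
  have En : ∀ (i : Fin 3) (U : E3 →L[ℝ] E3) (a : Fin 3), a ≠ i →
      (((flipIso i : E3 →L[ℝ] E3).comp (U.comp ((flipIso i).symm : E3 →L[ℝ] E3))) (EuclideanSpace.single i (1 : ℝ))) a =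
        -(U (EuclideanSpace.single i (1 : ℝ))) a := fun i U a ha => by
    rw [flip_entry, if_neg ha, if_pos rfl]; ring
  -- step 1: from the domain to «sorted, 0 ≤ u₀₁» (flip coordinate 2 if u₀₂ < 0)
  have hA : ∀ U : E3 →L[ℝ] E3, (∀ v w : E3, inner ℝ (U v) w = inner ℝ v (U w)) → (∀ w : E3, 0 ≤ inner ℝ w (U w)) → ‖U - 1‖ ≤ 1 / 4 →
      (U (EuclideanSpace.single 1 (1 : ℝ))) 1 ≤ (U (EuclideanSpace.single 0 (1 : ℝ))) 0 →
      (U (EuclideanSpace.single 2 (1 : ℝ))) 2 ≤ (U (EuclideanSpace.single 1 (1 : ℝ))) 1 →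
      0 ≤ (U (EuclideanSpace.single 1 (1 : ℝ))) 0 →
      (∀ (M : ℕ) (z : Fin M → E3) (c : Fin M), Function.Injective z →
          Set.range z = {x : E3 | dist x (z c) ≤ 133 / 10 ∧ ∃ a : Fin 3 → ℤ, x = z c + latPt U fccVec a} →
          TightNearCap (9 / 5) (3 / 2) z c ∨ ExemptNear (9 / 5) ExRec z c ∨ BadNearCap (9 / 5) (3 / 2) z c) ∨
      m ≤ (∑ b ∈ (Fintype.piFinset fun _ : Fin 3 => Finset.Icc (-7 : ℤ) 7).filter (fun b => b ≠ 0),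
        effPot w₄₅ ω₄ (3 / 400) ‖latPt U fccVec b‖) / 2 - (-(7175 / 10000) + 3 / 400) := by
    intro U hsa hpos hU h1 h2 h01
    rcases le_or_gt 0 ((U (EuclideanSpace.single 2 (1 : ℝ))) 0) with h02 | h02
    · exact h U hsa hpos hU h1 h2 h01 h02
    · refine dichotomy_of_flip 2 U hU (h _ (conjIso_selfAdjoint _ hsa) (conjIso_pos _ hpos)
        ((conjIso_norm_sub_one_le _ U).trans hU) ?_ ?_ ?_ ?_)
      · rw [E 2 U 1 1 (by decide) (by decide), E 2 U 0 0 (by decide) (by decide)]; exact h1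
      · rw [Ed 2 U, E 2 U 1 1 (by decide) (by decide)]; exact h2
      · rw [E 2 U 0 1 (by decide) (by decide)]; exact h01
      · rw [En 2 U 0 (by decide)]; linarith
  -- step 2: from «sorted, 0 ≤ u₀₁» to «sorted» (flip coordinate 1 if u₀₁ < 0), then `fccHalf_of_sorted`
  refine fccHalf_of_sorted fun U hsa hpos hU h1 h2 => ?_
  rcases le_or_gt 0 ((U (EuclideanSpace.single 1 (1 : ℝ))) 0) with h01 | h01
  · exact hA U hsa hpos hU h1 h2 h01
  · refine dichotomy_of_flip 1 U hU (hA _ (conjIso_selfAdjoint _ hsa) (conjIso_pos _ hpos)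
      ((conjIso_norm_sub_one_le _ U).trans hU) ?_ ?_ ?_)
    · rw [Ed 1 U, E 1 U 0 0 (by decide) (by decide)]; exact h1
    · rw [E 1 U 2 2 (by decide) (by decide), Ed 1 U]; exact h2
    · rw [En 1 U 0 (by decide)]; linarith

/-! ## §5. The certificate over the fundamental domain -/

/-- ★ **SIGN PRUNE**: the entry box has `u₀₁ < 0` or `u₀₂ < 0` throughout — a vacuous leaf on the fundamental domain. -/
def signOut (c w : Fin 3 × Fin 3 → ℤ) : Bool := decide (c (0, 1) + w (0, 1) < 0) || decide (c (0, 2) + w (0, 2) < 0)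

/-- Soundness of the sign prune. [folklore] -/
theorem false_of_signOut {c w : Fin 3 × Fin 3 → ℤ} (h : signOut c w = true) {u : Fin 3 × Fin 3 → ℝ}
    (hbox : ∀ ab, |u ab - (c ab : ℝ) / SC| ≤ (w ab : ℝ) / SC) (h01 : 0 ≤ u (0, 1)) (h02 : 0 ≤ u (0, 2)) : False := by
  have hS := SC_pos
  have key : ∀ ab : Fin 3 × Fin 3, 0 ≤ u ab → ¬ (c ab + w ab < 0) := by
    intro ab hle hlt
    have ha := (abs_le.1 (hbox ab)).2
    have hlt' : ((c ab : ℝ) + w ab) / SC < 0 := div_neg_of_neg_of_pos (by exact_mod_cast hlt) hS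
    rw [add_div] at hlt'
    linarith
  simp only [signOut, Bool.or_eq_true, decide_eq_true_eq] at h
  rcases h with h | h
  · exact key (0, 1) h01 h
  · exact key (0, 2) h02 h

/-- ★ **ENTRY-LEAF VERDICT OVER THE FUNDAMENTAL DOMAIN**: sign prune ∨ domain prune ∨ `entryLeafOKT μ`. -/
def entryLeafOKD (μ : ℤ) (c w : Fin 3 × Fin 3 → ℤ) : Bool := signOut c w || entryLeafOKS μ c w

/-- ★★ **THE fcc HALF FROM ONE TREE VERDICT OVER THE FUNDAMENTAL DOMAIN** (generic verdict, hver relativised to the domain). [folklore] -/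
theorem fccHalf_of_entryTreeDom {m : ℝ} {μ : ℤ} (hμ : 2 * (m + (-(7175 / 10000) + 3 / 400)) * SC ≤ μ)
    (verdict : (Fin 3 × Fin 3 → ℤ) → (Fin 3 × Fin 3 → ℤ) → Bool)
    (hver : ∀ c w, verdict c w = true → ∀ U : E3 →L[ℝ] E3, (∀ v v' : E3, ⟪U v, v'⟫ = ⟪v, U v'⟫) → ‖U - 1‖ ≤ 1 / 4 →
      (∀ ab : Fin 3 × Fin 3, |(U (EuclideanSpace.single ab.2 (1 : ℝ))) ab.1 - (c ab : ℝ) / SC| ≤ (w ab : ℝ) / SC) →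
      (U (EuclideanSpace.single 1 (1 : ℝ))) 1 ≤ (U (EuclideanSpace.single 0 (1 : ℝ))) 0 →
      (U (EuclideanSpace.single 2 (1 : ℝ))) 2 ≤ (U (EuclideanSpace.single 1 (1 : ℝ))) 1 →
      0 ≤ (U (EuclideanSpace.single 1 (1 : ℝ))) 0 → 0 ≤ (U (EuclideanSpace.single 2 (1 : ℝ))) 0 →
      (∀ (M : ℕ) (z : Fin M → E3) (c : Fin M), Function.Injective z →
          Set.range z = {x : E3 | dist x (z c) ≤ 133 / 10 ∧ ∃ a : Fin 3 → ℤ, x = z c + latPt U fccVec a} →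
          TightNearCap (9 / 5) (3 / 2) z c ∨ ExemptNear (9 / 5) ExRec z c ∨ BadNearCap (9 / 5) (3 / 2) z c) ∨
        (μ : ℝ) / SC ≤ ∑ b ∈ (Fintype.piFinset fun _ : Fin 3 => Finset.Icc (-7 : ℤ) 7).filter (fun b => b ≠ 0),
          effPot w₄₅ ω₄ (3 / 400) ‖latPt U fccVec b‖)
    {t : CertTree (Fin 3 × Fin 3)} (h : treeOK verdict t rootC rootW = true) :
    ∀ U : E3 →L[ℝ] E3, (∀ v w : E3, inner ℝ (U v) w = inner ℝ v (U w)) → (∀ w : E3, 0 ≤ inner ℝ w (U w)) → ‖U - 1‖ ≤ 1 / 4 →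
      (∀ (M : ℕ) (z : Fin M → E3) (c : Fin M), Function.Injective z →
          Set.range z = {x : E3 | dist x (z c) ≤ 133 / 10 ∧ ∃ a : Fin 3 → ℤ, x = z c + latPt U fccVec a} →
          TightNearCap (9 / 5) (3 / 2) z c ∨ ExemptNear (9 / 5) ExRec z c ∨ BadNearCap (9 / 5) (3 / 2) z c) ∨
      m ≤ (∑ b ∈ (Fintype.piFinset fun _ : Fin 3 => Finset.Icc (-7 : ℤ) 7).filter (fun b => b ≠ 0),
        effPot w₄₅ ω₄ (3 / 400) ‖latPt U fccVec b‖) / 2 - (-(7175 / 10000) + 3 / 400) := by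
  refine fccHalf_of_sortedSigned fun U hsa _hpos hU h1 h2 h01 h02 => ?_
  have hS := SC_pos
  have key := treeOK_sound SC_pos
    (P := fun x : Fin 3 × Fin 3 → ℝ => ∀ U : E3 →L[ℝ] E3, (∀ v v' : E3, ⟪U v, v'⟫ = ⟪v, U v'⟫) → ‖U - 1‖ ≤ 1 / 4 →
      (∀ ab : Fin 3 × Fin 3, (U (EuclideanSpace.single ab.2 (1 : ℝ))) ab.1 = x ab) →
      (U (EuclideanSpace.single 1 (1 : ℝ))) 1 ≤ (U (EuclideanSpace.single 0 (1 : ℝ))) 0 →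
      (U (EuclideanSpace.single 2 (1 : ℝ))) 2 ≤ (U (EuclideanSpace.single 1 (1 : ℝ))) 1 →
      0 ≤ (U (EuclideanSpace.single 1 (1 : ℝ))) 0 → 0 ≤ (U (EuclideanSpace.single 2 (1 : ℝ))) 0 →
      (∀ (M : ℕ) (z : Fin M → E3) (c : Fin M), Function.Injective z →
          Set.range z = {x : E3 | dist x (z c) ≤ 133 / 10 ∧ ∃ a : Fin 3 → ℤ, x = z c + latPt U fccVec a} →
          TightNearCap (9 / 5) (3 / 2) z c ∨ ExemptNear (9 / 5) ExRec z c ∨ BadNearCap (9 / 5) (3 / 2) z c) ∨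
        (μ : ℝ) / SC ≤ ∑ b ∈ (Fintype.piFinset fun _ : Fin 3 => Finset.Icc (-7 : ℤ) 7).filter (fun b => b ≠ 0),
          effPot w₄₅ ω₄ (3 / 400) ‖latPt U fccVec b‖)
    verdict (fun c w hv x hx V hVsa hV1 hVx => hver c w hv V hVsa hV1 fun ab => by rw [hVx ab]; exact hx ab) t rootC rootW h
    (fun ab => (U (EuclideanSpace.single ab.2 (1 : ℝ))) ab.1) (mem_root_of_near_one hU) U hsa hU (fun _ => rfl) h1 h2 h01 h02
  refine key.imp id fun hfloor => ?_
  have h2' : 2 * (m + (-(7175 / 10000) + 3 / 400)) ≤ (μ : ℝ) / SC := by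
    rw [le_div_iff₀ hS]; exact hμ
  linarith

/-- ★★ The same from ONE SEARCH Boolean with the domain verdict `entryLeafOKD μ`. [folklore] -/
theorem fccHalf_of_entrySearchDom {m : ℝ} {μ : ℤ} (hμ : 2 * (m + (-(7175 / 10000) + 3 / 400)) * SC ≤ μ)
    {sel : ℕ → (Fin 3 × Fin 3 → ℤ) → (Fin 3 × Fin 3 → ℤ) → Fin 3 × Fin 3} {fuel d : ℕ}
    (h : searchOK (entryLeafOKD μ) sel fuel d rootC rootW = true) :
    ∀ U : E3 →L[ℝ] E3, (∀ v w : E3, inner ℝ (U v) w = inner ℝ v (U w)) → (∀ w : E3, 0 ≤ inner ℝ w (U w)) → ‖U - 1‖ ≤ 1 / 4 →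
      (∀ (M : ℕ) (z : Fin M → E3) (c : Fin M), Function.Injective z →
          Set.range z = {x : E3 | dist x (z c) ≤ 133 / 10 ∧ ∃ a : Fin 3 → ℤ, x = z c + latPt U fccVec a} →
          TightNearCap (9 / 5) (3 / 2) z c ∨ ExemptNear (9 / 5) ExRec z c ∨ BadNearCap (9 / 5) (3 / 2) z c) ∨
      m ≤ (∑ b ∈ (Fintype.piFinset fun _ : Fin 3 => Finset.Icc (-7 : ℤ) 7).filter (fun b => b ≠ 0),
        effPot w₄₅ ω₄ (3 / 400) ‖latPt U fccVec b‖) / 2 - (-(7175 / 10000) + 3 / 400) := by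
  obtain ⟨t, ht⟩ := exists_tree_of_searchOK (entryLeafOKD μ) sel fuel d rootC rootW h
  refine fccHalf_of_entryTreeDom hμ (entryLeafOKD μ) (fun c w hv U hsa hU hbox h1 h2 h01 h02 => ?_) ht
  simp only [entryLeafOKD, Bool.or_eq_true] at hv
  rcases hv with hv | hv
  · exact (false_of_signOut hv (u := fun ab : Fin 3 × Fin 3 => (U (EuclideanSpace.single ab.2 (1 : ℝ))) ab.1) hbox h01 h02).elim
  · exact entryLeafOKS_sound hv U hsa hU hbox h1 h2

/-- ★★★ **`(H) HomFloor m` FROM TWO SEARCH BOOLEANS, fcc search over the FUNDAMENTAL DOMAIN only** (1/24 of the entry cube up to boundary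
boxes: sorted diagonal, `u₀₁, u₀₂ ≥ 0`); hcp side hand-2's `entryLeafOKH2 μ`. [folklore] -/
theorem homFloor_of_entrySearchesDom {m : ℝ} {μ : ℤ} (hμ : 2 * (m + (-(7175 / 10000) + 3 / 400)) * SC ≤ μ)
    {selF : ℕ → (Fin 3 × Fin 3 → ℤ) → (Fin 3 × Fin 3 → ℤ) → Fin 3 × Fin 3} {fuelF dF : ℕ}
    (hF : searchOK (entryLeafOKD μ) selF fuelF dF rootC rootW = true)
    {selH : ℕ → ((Fin 3 × Fin 3) ⊕ Fin 3 → ℤ) → ((Fin 3 × Fin 3) ⊕ Fin 3 → ℤ) → (Fin 3 × Fin 3) ⊕ Fin 3} {fuelH dH : ℕ}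
    (hH : searchOK (entryLeafOKH2 μ) selH fuelH dH rootCH rootWH = true) : HomFloor m :=
  homFloor_of_prunedBoxSums_selfAdjoint (fccHalf_of_entrySearchDom hμ hF)
    (hcpHalf_of_entrySearch hμ (entryLeafOKH2 μ) (fun _ _ hv U ξ hsa hU hbox hξ => entryLeafOKH2_sound hv U ξ hsa hU hbox hξ) hH)

/-- Kernel smoke test: the sign prune fires on a box with `u₀₁ < 0` throughout, not on the root cube. -/
example : signOut (Function.update rootC (0, 1) (-3000)) (fun _ => 1000) = true ∧ signOut rootC rootW = false ∧
    entryLeafOKD muRec (Function.update rootC (0, 1) (-3000)) (fun _ => 1000) = true := by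
  decide +kernel

end Summit.AtomisticToContinuum.Crystallization.Theorems.FrustratedLawDichotomyStrainedPatchHomEntrySign
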